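import Mathlib.Probability.Kernel.MeasurableIntegral
import Mathlib.MeasureTheory.Integral.IntervalIntegral.Basic
import Mathlib.Topology.ContinuousMap.Bounded.Normed
import Literature.MathematicalPhysics.KineticTheory.FouriersLaw

/-!
# Finite-bias Clausius (stub `stub_finiteBiasClausius`), helper 3: Cesàro limits beyond bounded observables

Helper file for crux `stmt-AtomisticToContinuum-9122` (`BondHeatUncertainty.LinearResponseFTUR`), line
`lebesgue-flip-duality`, stub `stub_finiteBiasClausius`. Theorems only, abstract measure theory. The
Krylov–Bogoliubov–Cesàro limit of helper 2 is a WEAK limit (bounded continuous test functions); the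
observable of the finite-bias Clausius inequality, the injected power `p_0 ∂_{q_0}H`, is continuous but
unbounded. Uniform Lyapunov moments close the gap:

* `integral_truncation_estimate` — on a probability space with `∫ V ≤ C < ∞`, an observable with
  `ψ² ≤ K V` is integrable, `|∫ψ| ≤ (1 + KC)/2`, and its truncation at level `R` moves the integral by
  at most `KC/R`;
* `tendsto_cesaro_of_sq_le` — hence Cesàro limits against bounded continuous functions of a measurable
  family of probability measures with `∫ V d(ρ s) ≤ C`, towards a limit `μ` with `∫ V dμ ≤ C`, extend to
  every continuous `ψ` with `ψ² ≤ K V`;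
* `pinnedChain_tendsto_cesaro_of_sq_le` — the same on the phase space of the oscillator chain
  (registered sub-goal of the stub; no new content).

Nothing here closes an item.
-/

noncomputable section

namespace Summit.AtomisticToContinuum.FouriersLaw.Theorems.LinearResponseFTUR

open MeasureTheory ProbabilityTheory Filter Topology Set
open scoped NNReal ENNReal BoundedContinuousFunction

variable {X : Type*} [MeasurableSpace X]

/-! ### From bounded continuous observables to observables with a second Lyapunov moment -/

/-- **Truncation against a Lyapunov moment.** On a probability space with `∫ V ≤ C < ∞`, an
observable `ψ` with `ψ² ≤ K V` is integrable, `|∫ ψ| ≤ (1 + K C)/2`, and replacing `ψ` by its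
truncation `ψ_R = max(-R, min(ψ, R))` (`R > 0`) changes the integral by at most `K C / R`
(`|ψ - ψ_R| ≤ ψ²/R`). -/
theorem integral_truncation_estimate {ρ : Measure X} [IsProbabilityMeasure ρ] {V : X → ℝ≥0}
    (hV : Measurable V) {C : ℝ≥0∞} (hC : C ≠ ⊤) (hρ : ∫⁻ x, V x ∂ρ ≤ C) {ψ : X → ℝ}
    (hψ : StronglyMeasurable ψ) {K : ℝ≥0} (hψV : ∀ x, ψ x ^ 2 ≤ K * V x) {R : ℝ} (hR : 0 < R) :
    Integrable ψ ρ ∧ |∫ x, ψ x ∂ρ| ≤ (1 + K * C.toReal) / 2 ∧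
      |∫ x, ψ x ∂ρ - ∫ x, max (-R) (min (ψ x) R) ∂ρ| ≤ K * C.toReal / R := by
  -- the Lyapunov observable is integrable with integral `≤ C`
  have hVint : Integrable (fun x => (V x : ℝ)) ρ := by
    have h := integrable_toReal_of_lintegral_ne_top (hV.coe_nnreal_ennreal).aemeasurable
      (ne_top_of_le_ne_top hC hρ)
    simpa using h
  have hVle : ∫ x, (V x : ℝ) ∂ρ ≤ C.toReal := by
    have h1 : ∫⁻ x, (V x : ℝ≥0∞) ∂ρ = ENNReal.ofReal (∫ x, (V x : ℝ) ∂ρ) := lintegral_coe_eq_integral V hVint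
    rw [h1] at hρ
    exact (ENNReal.ofReal_le_iff_le_toReal hC).1 hρ
  -- `|ψ| ≤ (1 + ψ²)/2 ≤ (1 + K V)/2` and `ψ² ≤ K V`
  have hbound1 : ∀ x, ‖ψ x‖ ≤ (1 + K * V x) / 2 := fun x => by
    rw [Real.norm_eq_abs]
    have h2 : 2 * |ψ x| ≤ 1 + ψ x ^ 2 := by nlinarith [sq_abs (ψ x), sq_nonneg (|ψ x| - 1)]
    linarith [hψV x]
  have hdom1 : Integrable (fun x => (1 + K * (V x : ℝ)) / 2) ρ :=
    ((integrable_const 1).add (hVint.const_mul K)).div_const 2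
  have hψint : Integrable ψ ρ := hdom1.mono' hψ.aestronglyMeasurable (Eventually.of_forall hbound1)
  have hψ2int : Integrable (fun x => ψ x ^ 2) ρ := by
    refine (hVint.const_mul K).mono' (hψ.aestronglyMeasurable.pow 2) (Eventually.of_forall fun x => ?_)
    rw [Real.norm_eq_abs, abs_of_nonneg (sq_nonneg _)]
    exact hψV x
  -- the truncation is bounded and measurable
  set ψR : X → ℝ := fun x => max (-R) (min (ψ x) R) with hψR
  have hψRm' : StronglyMeasurable ψR :=
    (measurable_const.max (hψ.measurable.min measurable_const)).stronglyMeasurable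
  have hψRb : ∀ x, ‖ψR x‖ ≤ R := fun x => by
    rw [Real.norm_eq_abs, abs_le]
    exact ⟨le_max_left _ _, max_le (by linarith) (min_le_right _ _)⟩
  have hψRint : Integrable ψR ρ :=
    (integrable_const R).mono' hψRm'.aestronglyMeasurable (Eventually.of_forall hψRb)
  -- `|ψ - ψ_R| ≤ ψ²/R`
  have hdiff : ∀ x, |ψ x - ψR x| ≤ ψ x ^ 2 / R := fun x => by
    by_cases h : |ψ x| ≤ R
    · have h1 : ψR x = ψ x := by
        rw [abs_le] at h
        simp only [hψR, min_eq_left h.2, max_eq_right h.1]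
      rw [h1, sub_self, abs_zero]
      positivity
    · have hlt : R < |ψ x| := lt_of_not_ge h
      have h1 : |ψ x - ψR x| ≤ |ψ x| := by
        rcases le_total 0 (ψ x) with h0 | h0
        · have hψx : R < ψ x := by rwa [abs_of_nonneg h0] at hlt
          have : ψR x = R := by
            simp only [hψR, min_eq_right hψx.le]; exact max_eq_right (by linarith)
          rw [this, abs_of_nonneg h0, abs_of_nonneg (by linarith)]
          linarith
        · have hψx : ψ x < -R := by rw [abs_of_nonpos h0] at hlt; linarith
          have : ψR x = -R := by
            simp only [hψR, min_eq_left (show ψ x ≤ R by linarith)]; exact max_eq_left hψx.le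
          rw [this, abs_of_nonpos h0, sub_neg_eq_add, abs_of_nonpos (by linarith)]
          linarith
      have h2 : |ψ x| ≤ ψ x ^ 2 / R := by
        rw [le_div_iff₀ hR, ← sq_abs]
        nlinarith [abs_nonneg (ψ x)]
      exact h1.trans h2
  refine ⟨hψint, ?_, ?_⟩
  · calc |∫ x, ψ x ∂ρ| ≤ ∫ x, |ψ x| ∂ρ := abs_integral_le_integral_abs
      _ ≤ ∫ x, (1 + K * (V x : ℝ)) / 2 ∂ρ :=
          integral_mono hψint.abs hdom1 fun x => by simpa [Real.norm_eq_abs] using hbound1 x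
      _ = (1 + K * ∫ x, (V x : ℝ) ∂ρ) / 2 := by
          rw [integral_div, integral_add (integrable_const 1) (hVint.const_mul K), integral_const,
            integral_const_mul]
          simp
      _ ≤ (1 + K * C.toReal) / 2 := by gcongr
  · rw [← integral_sub hψint hψRint]
    calc |∫ x, ψ x - ψR x ∂ρ| ≤ ∫ x, |ψ x - ψR x| ∂ρ := abs_integral_le_integral_abs
      _ ≤ ∫ x, ψ x ^ 2 / R ∂ρ := integral_mono (hψint.sub hψRint).abs (hψ2int.div_const R) hdiff
      _ = (∫ x, ψ x ^ 2 ∂ρ) / R := integral_div R _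
      _ ≤ (K * ∫ x, (V x : ℝ) ∂ρ) / R := by
          gcongr
          rw [← integral_const_mul]
          exact integral_mono hψ2int (hVint.const_mul K) hψV
      _ ≤ K * C.toReal / R := by gcongr

/-- **Cesàro limits extend from bounded continuous observables to observables with a second
Lyapunov moment.** If the Cesàro averages over `(0, φ k + 1]` of a measurable family of probability
measures `ρ s` converge against every bounded continuous `g` to `∫ g dμ`, and `∫ V d(ρ s) ≤ C`,
`∫ V dμ ≤ C < ∞` for a continuous `V ≥ 0`, then they converge against every continuous `ψ` with
`ψ² ≤ K V` to `∫ ψ dμ` (truncate `ψ` at level `R`, `integral_truncation_estimate`, and let `R → ∞`). -/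
theorem tendsto_cesaro_of_sq_le [TopologicalSpace X] [OpensMeasurableSpace X]
    (ρ : ℝ → Measure X) (hρm : Measurable ρ) [∀ s, IsProbabilityMeasure (ρ s)]
    (μ : Measure X) [IsProbabilityMeasure μ] {V : X → ℝ≥0} (hV : Continuous V) {C : ℝ≥0∞}
    (hC : C ≠ ⊤) (hρV : ∀ s, ∫⁻ x, V x ∂(ρ s) ≤ C) (hμV : ∫⁻ x, V x ∂μ ≤ C) {φ : ℕ → ℕ}
    (hlim : ∀ g : X →ᵇ ℝ, Tendsto (fun k => ((φ k : ℝ) + 1)⁻¹ *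
        ∫ s in (0:ℝ)..((φ k : ℝ) + 1), ∫ y, g y ∂(ρ s)) atTop (𝓝 (∫ x, g x ∂μ)))
    {ψ : X → ℝ} (hψ : Continuous ψ) {K : ℝ≥0} (hψV : ∀ x, ψ x ^ 2 ≤ K * V x) :
    Tendsto (fun k => ((φ k : ℝ) + 1)⁻¹ * ∫ s in (0:ℝ)..((φ k : ℝ) + 1), ∫ y, ψ y ∂(ρ s))
      atTop (𝓝 (∫ x, ψ x ∂μ)) := by
  have hVm : Measurable V := hV.measurable
  have hψm : StronglyMeasurable ψ := hψ.stronglyMeasurable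
  -- the orbit observable `m s = ∫ ψ d(ρ s)` is measurable and bounded
  let η : Kernel ℝ X := ⟨ρ, hρm⟩
  set B : ℝ := (1 + K * C.toReal) / 2 with hB
  set m : ℝ → ℝ := fun s => ∫ y, ψ y ∂(ρ s) with hm
  have hm_meas : StronglyMeasurable m := hψm.integral_kernel (κ := η)
  have hm_bd : ∀ s, ‖m s‖ ≤ B := fun s =>
    (integral_truncation_estimate hVm hC (hρV s) hψm hψV one_pos).2.1
  have hmint : ∀ a b : ℝ, IntervalIntegrable m volume a b := fun a b =>
    (intervalIntegrable_const (c := B)).mono_fun' hm_meas.aestronglyMeasurable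
      (Eventually.of_forall fun s => hm_bd s)
  rw [Metric.tendsto_atTop]
  intro ε hε
  -- truncation level `R` with `K C / R < ε / 3`
  obtain ⟨R, hR, hKR⟩ : ∃ R : ℝ, 0 < R ∧ K * C.toReal / R < ε / 3 := by
    refine ⟨3 * (K * C.toReal) / ε + 1, by positivity, ?_⟩
    have hKC : 0 ≤ (K : ℝ) * C.toReal := by positivity
    have hR3 : ε / 3 * (3 * (K * C.toReal) / ε + 1) = K * C.toReal + ε / 3 := by
      field_simp
    rw [div_lt_iff₀ (by positivity), hR3]
    linarith
  -- the truncated observable as a bounded continuous function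
  have hψRc : Continuous fun x => max (-R) (min (ψ x) R) :=
    continuous_const.max (hψ.min continuous_const)
  have hψRb : ∀ x, ‖max (-R) (min (ψ x) R)‖ ≤ R := fun x => by
    rw [Real.norm_eq_abs, abs_le]
    exact ⟨le_max_left _ _, max_le (by linarith) (min_le_right _ _)⟩
  let g : X →ᵇ ℝ := BoundedContinuousFunction.ofNormedAddCommGroup _ hψRc R hψRb
  have hg : ∀ x, g x = max (-R) (min (ψ x) R) := fun x => rfl
  set mR : ℝ → ℝ := fun s => ∫ y, g y ∂(ρ s) with hmR
  have hmR_meas : StronglyMeasurable mR := g.continuous.stronglyMeasurable.integral_kernel (κ := η)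
  have hmR_bd : ∀ s, ‖mR s‖ ≤ R := fun s => by
    calc ‖∫ y, g y ∂(ρ s)‖ ≤ R * (ρ s).real univ :=
          norm_integral_le_of_norm_le_const (Eventually.of_forall hψRb)
      _ = R := by simp
  have hmRint : ∀ a b : ℝ, IntervalIntegrable mR volume a b := fun a b =>
    (intervalIntegrable_const (c := R)).mono_fun' hmR_meas.aestronglyMeasurable
      (Eventually.of_forall fun s => hmR_bd s)
  -- pointwise-in-time and limit truncation errors
  have herr_s : ∀ s, |m s - mR s| ≤ K * C.toReal / R := fun s =>
    (integral_truncation_estimate hVm hC (hρV s) hψm hψV hR).2.2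
  have herr_μ : |∫ x, ψ x ∂μ - ∫ x, g x ∂μ| ≤ K * C.toReal / R :=
    (integral_truncation_estimate hVm hC hμV hψm hψV hR).2.2
  -- Cesàro truncation error
  have herr_ces : ∀ k : ℕ, |((φ k : ℝ) + 1)⁻¹ * (∫ s in (0:ℝ)..((φ k : ℝ) + 1), m s) -
      ((φ k : ℝ) + 1)⁻¹ * (∫ s in (0:ℝ)..((φ k : ℝ) + 1), mR s)| ≤ K * C.toReal / R := by
    intro k
    have hT : (0 : ℝ) < (φ k : ℝ) + 1 := by positivity
    rw [← mul_sub, ← intervalIntegral.integral_sub (hmint _ _) (hmRint _ _), abs_mul,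
      abs_of_pos (inv_pos.2 hT)]
    have h := intervalIntegral.norm_integral_le_of_norm_le_const (a := (0:ℝ)) (b := (φ k : ℝ) + 1)
      (C := K * C.toReal / R) (f := fun s => m s - mR s) fun s _ => by
        rw [Real.norm_eq_abs]; exact herr_s s
    rw [Real.norm_eq_abs, sub_zero, abs_of_pos hT] at h
    calc ((φ k : ℝ) + 1)⁻¹ * |∫ s in (0:ℝ)..((φ k : ℝ) + 1), (m s - mR s)|
        ≤ ((φ k : ℝ) + 1)⁻¹ * (K * C.toReal / R * ((φ k : ℝ) + 1)) := by gcongr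
      _ = K * C.toReal / R := by field_simp
  -- conclude with an `ε/3` argument
  obtain ⟨N₀, hN₀⟩ := (Metric.tendsto_atTop.1 (hlim g)) (ε / 3) (by positivity)
  refine ⟨N₀, fun k hk => ?_⟩
  have h1 := herr_ces k
  have h2 := hN₀ k hk
  rw [Real.dist_eq] at h2 ⊢
  have h2' : |((φ k : ℝ) + 1)⁻¹ * (∫ s in (0:ℝ)..((φ k : ℝ) + 1), mR s) - ∫ x, g x ∂μ| < ε / 3 := h2
  have h3 := herr_μ
  rw [abs_sub_comm] at h3
  have e1 := abs_sub_le (((φ k : ℝ) + 1)⁻¹ * (∫ s in (0:ℝ)..((φ k : ℝ) + 1), m s))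
    (((φ k : ℝ) + 1)⁻¹ * (∫ s in (0:ℝ)..((φ k : ℝ) + 1), mR s)) (∫ x, ψ x ∂μ)
  have e2 := abs_sub_le (((φ k : ℝ) + 1)⁻¹ * (∫ s in (0:ℝ)..((φ k : ℝ) + 1), mR s))
    (∫ x, g x ∂μ) (∫ x, ψ x ∂μ)
  show |((φ k : ℝ) + 1)⁻¹ * (∫ s in (0:ℝ)..((φ k : ℝ) + 1), m s) - ∫ x, ψ x ∂μ| < ε
  linarith

open Literature.MathematicalPhysics.KineticTheory.HeatConduction in
/-- **Cesàro limits beyond bounded observables, on the phase space of the oscillator chain**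
(registered sub-goal of `stub_finiteBiasClausius`; `tendsto_cesaro_of_sq_le` verbatim): Cesàro limits
of a measurable family of probability measures `ρ s` against bounded continuous functions, with uniform
Lyapunov moments `∫ V d(ρ s) ≤ C`, `∫ V dμ ≤ C < ∞`, extend to continuous `ψ` with `ψ² ≤ K V`. -/
theorem pinnedChain_tendsto_cesaro_of_sq_le :
    ∀ (N : ℕ) (ρ : ℝ → Measure (PhaseSpace N)), Measurable ρ → (∀ s, IsProbabilityMeasure (ρ s)) →
    ∀ (μ : Measure (PhaseSpace N)) [IsProbabilityMeasure μ] (V : PhaseSpace N → ℝ≥0), Continuous V →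
    ∀ (C : ℝ≥0∞), C ≠ ⊤ → (∀ s, ∫⁻ x, V x ∂(ρ s) ≤ C) → ∫⁻ x, V x ∂μ ≤ C →
    ∀ (φ : ℕ → ℕ), (∀ g : BoundedContinuousFunction (PhaseSpace N) ℝ,
      Tendsto (fun k => ((φ k : ℝ) + 1)⁻¹ * ∫ s in (0:ℝ)..((φ k : ℝ) + 1), ∫ y, g y ∂(ρ s))
        atTop (𝓝 (∫ x, g x ∂μ))) →
    ∀ (ψ : PhaseSpace N → ℝ), Continuous ψ → ∀ K : ℝ≥0, (∀ x, ψ x ^ 2 ≤ K * V x) →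
    Tendsto (fun k => ((φ k : ℝ) + 1)⁻¹ * ∫ s in (0:ℝ)..((φ k : ℝ) + 1), ∫ y, ψ y ∂(ρ s))
      atTop (𝓝 (∫ x, ψ x ∂μ)) := by
  intro N ρ hρm hρ μ _ V hV C hC hρV hμV φ hlim ψ hψ K hψV
  haveI := hρ
  exact tendsto_cesaro_of_sq_le ρ hρm μ hV hC hρV hμV hlim hψ hψV

end Summit.AtomisticToContinuum.FouriersLaw.Theorems.LinearResponseFTUR

end
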